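import Summits.SmoothPoincare4.SmoothPoincare4.Theorems.CongruenceShadowsShadowApproximationStubLayerStepOneZeroAssembly
import HarnessLib

/-!
# Helper for stub `stub_layerStepTwoZero` (line `nilpotent-genus-class`, crux
`CongruenceShadows.ShadowApproximation`, item stmt-SmoothPoincare4-14595):
# conjugated seed realisers at genus `9` and their readings, transported along handle permutations

`S = SurfaceGroup 9` (`9 = 3 + 3·2`), `N i = s4Kernels.stabilizeIter 2 i`, `H₁ = ℤ^{Fin 9 × Bool}`, `γₖ₊₁ = (⊤).lowerCentralSeries k`,
`π` the erasing projection of the slot-`2` cut pattern `ct`.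

* §1 `exists_conj_realiser₉` — the genus-`9` twin of the landed genus-`6` `exists_conj_realiser`: for an integer matrix `M`
  passing the decidable Goeritz checks (realised by `x ∈ Stab N₀ ∩ Stab N₁`, landed `exists_goeritz_of_matrix`) and a
  handle `k`, `y = x bp_{k,k+1} x⁻¹ ∈ Stab N₀ ∩ Stab N₁` is IA and reads as the closed form `RD(M, M', k)` (landed
  `exists_bp_handle 6 k`, `johnson_conj_seed`, `reading_of_table`).
* §2 `sum_mul_pairing_true/false` — the sums `∑ₓ M' x t · ⟨x, u⟩` in `RD` have one term.
* §3 handle permutations: for a residue-preserving permutation `τ` of the handles (inverse `σ`), the matrices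
  `M^τ p q = M (τ p.1, p.2) q`, `M'^τ p q = M' p (τ q.1, q.2)` (i.e. `P_σ M`, `M' P_σ⁻¹`) pass the Goeritz checks as soon
  as `M, M'` do (`perm_mul_eq_one`, `perm_mul_eq_one'`, `symplForm_perm`, block vanishing) — so ONE checked base matrix
  serves a whole orbit of realisers.
* §4 `exists_perm_conj_realiser₉` — the realiser of `(P_σ M, k)` with its reading in the COLLAPSED closed form
  `RD'(j, v, w) = s_j (E'(j,v,w) - E'(j,w,v))`,
  `E'(j,p,q) = M'_{(k,a)}^{τj} M^{τp}_{(k,a)} M^{τq}_{(k+1,b)} - M'_{(k,b)}^{τj} M^{τp}_{(k+1,b)} M^{τq}_{(k,b)} + M'_{(k+1,a)}^{τj} M^{τp}_{(k,b)} M^{τq}_{(k,a)}`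
  (`M^{h}_{Z} = M (τ h, y_h) Z` the survivor coordinate of handle `h` of the column `Z`, `M'^{τj}_{Z} = M' Z (τ j, x_j)`), the
  format consumed by the genus-`9` assembly.
No definitions; the registered helper is `helper_symplFormPerm`.
-/

set_option linter.dupNamespace false

noncomputable section

open Subgroup Literature.Topology.FourManifolds Literature.Algebra.Lie Multiplicative
open Summit.SmoothPoincare4.SmoothPoincare4.Theorems.NilpotentShadowsStandard.SaturatedTorsorDescent
open scoped commutatorElement

namespace Summit.SmoothPoincare4.SmoothPoincare4.Theorems.ShadowApproximation.NilpotentGenusClass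

/-! ## §1 Conjugated seed realisers at genus `9` -/

section ConjRealiser

/-- **A conjugated seed realiser and its reading** (genus `9 = 3 + 3·2`; the genus-`6` twin is the landed `exists_conj_realiser`).  For a matrix `M` as in
`exists_goeritz_of_matrix` (realised by `x ∈ Stab N₀ ∩ Stab N₁`) and a handle `k`, the conjugate `y = x β x⁻¹` of the
bounding-pair map `β = bp_{k,k+1}` lies in `Stab N₀ ∩ Stab N₁`, is IA, and for the cut pattern `ct` of slot `2` with
erasing projection `π` its corrections at the cut letters read as the pair products of the closed-form reading
`RD(M, M', k) j v w = s_j · (E(x_j, y_v, y_w) - E(x_j, y_w, y_v))`, `E` the conjugated Johnson table of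
`johnson_conj_seed` for the triple `(b_k, a_k, b_{k+1})`, `s_j = -1` on `b`-cut handles. [folklore] -/
theorem exists_conj_realiser₉ (k : Fin (3 + 3 * 2)) (M M' : Matrix (Fin (3 + 3 * 2) × Bool) (Fin (3 + 3 * 2) × Bool) ℤ)
    (ε : ℤ) (hε : ε = 1 ∨ ε = -1) (h1 : M * M' = 1) (h2 : M' * M = 1)
    (hS : ∀ x y : Fin (3 + 3 * 2) × Bool, symplForm (fun k => M k x) (fun k => M k y) =
      ε * symplForm (Pi.single x (1 : ℤ) : Fin (3 + 3 * 2) × Bool → ℤ) (Pi.single y (1 : ℤ)))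
    (h0 : ∀ i j : Fin (3 + 3 * 2), M (i, !decide ((i : ℕ) % 3 = 2)) (j, decide ((j : ℕ) % 3 = 2)) = 0)
    (h1' : ∀ i j : Fin (3 + 3 * 2), M (i, !decide ((i : ℕ) % 3 = 1)) (j, decide ((j : ℕ) % 3 = 1)) = 0)
    {ct : Fin (3 + 3 * 2) → Bool} {π : (SurfaceGroup (3 + 3 * 2)) →* (FreeGroup (Fin (3 + 3 * 2)))} (hπs : Function.Surjective π)
    (hπof : ∀ (h : Fin (3 + 3 * 2)) (b : Bool), π (PresentedGroup.of (h, b)) = if b = ct h then 1 else FreeGroup.of h) :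
    ∃ y : (SurfaceGroup (3 + 3 * 2)) ≃* (SurfaceGroup (3 + 3 * 2)),
      (s4Kernels.stabilizeIter 2 0).map y.toMonoidHom = s4Kernels.stabilizeIter 2 0 ∧
      (s4Kernels.stabilizeIter 2 1).map y.toMonoidHom = s4Kernels.stabilizeIter 2 1 ∧
      (∀ s : (SurfaceGroup (3 + 3 * 2)), y s * s⁻¹ ∈ ((⊤ : Subgroup (SurfaceGroup (3 + 3 * 2))).lowerCentralSeries 1)) ∧
      ∀ j : Fin (3 + 3 * 2), π (y (PresentedGroup.of (j, ct j)) * (PresentedGroup.of (j, ct j))⁻¹) *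
        (((List.finRange (3 + 3 * 2)).map (fun v => ((List.finRange (3 + 3 * 2)).map (fun w => if v < w then ⁅(FreeGroup.of v : FreeGroup (Fin (3 + 3 * 2))), FreeGroup.of w⁆ ^ ( (if ct j then (-1 : ℤ) else 1) * ((if ct j then (-1 : ℤ) else 1) * (((∑ x : Fin (3 + 3 * 2) × Bool, M' x (j, ct j) * (if x.1 = ((k : Fin (3 + 3 * 2)), true).1 ∧ x.2 = false ∧ ((k : Fin (3 + 3 * 2)), true).2 = true then (1 : ℤ) else if x.1 = ((k : Fin (3 + 3 * 2)), true).1 ∧ x.2 = true ∧ ((k : Fin (3 + 3 * 2)), true).2 = false then (-1 : ℤ) else 0)) * (M (v, !ct v) ((k : Fin (3 + 3 * 2)), false) * M (w, !ct w) ((k : Fin (3 + 3 * 2)) + 1, true)) + (∑ x : Fin (3 + 3 * 2) × Bool, M' x (j, ct j) * (if x.1 = ((k : Fin (3 + 3 * 2)), false).1 ∧ x.2 = false ∧ ((k : Fin (3 + 3 * 2)), false).2 = true then (1 : ℤ) else if x.1 = ((k : Fin (3 + 3 * 2)), false).1 ∧ x.2 = true ∧ ((k : Fin (3 + 3 * 2)),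 false).2 = false then (-1 : ℤ) else 0)) * (M (v, !ct v) ((k : Fin (3 + 3 * 2)) + 1, true) * M (w, !ct w) ((k : Fin (3 + 3 * 2)), true)) + (∑ x : Fin (3 + 3 * 2) × Bool, M' x (j, ct j) * (if x.1 = ((k : Fin (3 + 3 * 2)) + 1, true).1 ∧ x.2 = false ∧ ((k : Fin (3 + 3 * 2)) + 1, true).2 = true then (1 : ℤ) else if x.1 = ((k : Fin (3 + 3 * 2)) + 1, true).1 ∧ x.2 = true ∧ ((k : Fin (3 + 3 * 2)) + 1, true).2 = false then (-1 : ℤ) else 0)) * (M (v, !ct v) ((k : Fin (3 + 3 * 2)), true) * M (w, !ct w) ((k : Fin (3 + 3 * 2)), false))) - ((∑ x : Fin (3 + 3 * 2) × Bool, M' x (j, ct j) * (if x.1 = ((k : Fin (3 + 3 * 2)), true).1 ∧ x.2 = false ∧ ((k : Fin (3 + 3 * 2)), true).2 = true then (1 : ℤ) else if x.1 = ((k : Fin (3 + 3 * 2)), true).1 ∧ x.2 = true ∧ ((k : Fin (3 + 3 * 2)), true).2 = false then (-1 : ℤ) else 0)) * (M (w, !ct w) ((k : Fin (3 + 3 *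 2)), false) * M (v, !ct v) ((k : Fin (3 + 3 * 2)) + 1, true)) + (∑ x : Fin (3 + 3 * 2) × Bool, M' x (j, ct j) * (if x.1 = ((k : Fin (3 + 3 * 2)), false).1 ∧ x.2 = false ∧ ((k : Fin (3 + 3 * 2)), false).2 = true then (1 : ℤ) else if x.1 = ((k : Fin (3 + 3 * 2)), false).1 ∧ x.2 = true ∧ ((k : Fin (3 + 3 * 2)), false).2 = false then (-1 : ℤ) else 0)) * (M (w, !ct w) ((k : Fin (3 + 3 * 2)) + 1, true) * M (v, !ct v) ((k : Fin (3 + 3 * 2)), true)) + (∑ x : Fin (3 + 3 * 2) × Bool, M' x (j, ct j) * (if x.1 = ((k : Fin (3 + 3 * 2)) + 1, true).1 ∧ x.2 = false ∧ ((k : Fin (3 + 3 * 2)) + 1, true).2 = true then (1 : ℤ) else if x.1 = ((k : Fin (3 + 3 * 2)) + 1, true).1 ∧ x.2 = true ∧ ((k : Fin (3 + 3 * 2)) + 1, true).2 = false then (-1 : ℤ) else 0)) * (M (w, !ct w) ((k : Fin (3 + 3 * 2)), true) * M (v, !ct v) ((k : Fin (3 + 3 * 2)), false))))) ) else (1 :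 FreeGroup (Fin (3 + 3 * 2))))).prod)).prod)⁻¹ ∈ ((⊤ : Subgroup (FreeGroup (Fin (3 + 3 * 2)))).lowerCentralSeries 2) := by
  obtain ⟨x, hx0, hx1, hM, hM'⟩ := exists_goeritz_of_matrix (m := 2) M M' ε hε h1 h2 hS h0 h1'
  obtain ⟨β, hβIA, hβτ, hβcut⟩ := exists_bp_handle 6 k
  have hβ0 : (s4Kernels.stabilizeIter 2 0).map β.toMonoidHom = s4Kernels.stabilizeIter 2 0 := by
    rw [stabilizeIter_eq_cutKernel]; exact hβcut _
  have hβ1 : (s4Kernels.stabilizeIter 2 1).map β.toMonoidHom = s4Kernels.stabilizeIter 2 1 := by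
    rw [stabilizeIter_eq_cutKernel]; exact hβcut _
  obtain ⟨cS, hcS⟩ : ∃ cS : Fin (3 + 3 * 2) × Bool → Fin (3 + 3 * 2) × Bool → (Subgroup.center (SurfaceGroup (3 + 3 * 2) ⧸ (⊤ : Subgroup (SurfaceGroup (3 + 3 * 2))).lowerCentralSeries 2)),
      ∀ p q, (cS p q : (SurfaceGroup (3 + 3 * 2) ⧸ (⊤ : Subgroup (SurfaceGroup (3 + 3 * 2))).lowerCentralSeries 2)) = ⁅((PresentedGroup.of p : (SurfaceGroup (3 + 3 * 2))) : (SurfaceGroup (3 + 3 * 2) ⧸ (⊤ : Subgroup (SurfaceGroup (3 + 3 * 2))).lowerCentralSeries 2)), ((PresentedGroup.of q : (SurfaceGroup (3 + 3 * 2))) : (SurfaceGroup (3 + 3 * 2) ⧸ (⊤ : Subgroup (SurfaceGroup (3 + 3 * 2))).lowerCentralSeries 2))⁆ :=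
    ⟨fun p q => ⟨_, c2_mem_center quot_class_two _ _⟩, fun p q => rfl⟩
  refine ⟨x.symm.trans (β.trans x), map_conj_of_map_eq x β hx0 hβ0, map_conj_of_map_eq x β hx1 hβ1, ia_conj hβIA x,
    fun j => ?_⟩
  have hE := johnson_conj_seed (k, true) (k, false) (k + 1, true) β x hβIA hβτ M M' hM hM' cS hcS
  have hread := reading_of_table ct π hπs hπof (x.symm.trans (β.trans x)) cS hcS _ hE j
  have key : (((List.finRange (3 + 3 * 2)).map (fun v => ((List.finRange (3 + 3 * 2)).map (fun w => if v < w then ⁅(FreeGroup.of v : FreeGroup (Fin (3 + 3 * 2))), FreeGroup.of w⁆ ^ ( (if ct j then (-1 : ℤ) else 1) * ((if ct j then (-1 : ℤ) else 1) * (((∑ x : Fin (3 + 3 * 2) × Bool, M' x (j, ct j) * (if x.1 = ((k : Fin (3 + 3 * 2)), true).1 ∧ x.2 = false ∧ ((k : Fin (3 + 3 * 2)), true).2 = true then (1 : ℤ) else if x.1 = ((k : Fin (3 + 3 * 2)), true).1 ∧ x.2 = true ∧ ((k : Fin (3 + 3 * 2)), true).2 = false then (-1 : ℤ) else 0)) *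 (M (v, !ct v) ((k : Fin (3 + 3 * 2)), false) * M (w, !ct w) ((k : Fin (3 + 3 * 2)) + 1, true)) + (∑ x : Fin (3 + 3 * 2) × Bool, M' x (j, ct j) * (if x.1 = ((k : Fin (3 + 3 * 2)), false).1 ∧ x.2 = false ∧ ((k : Fin (3 + 3 * 2)), false).2 = true then (1 : ℤ) else if x.1 = ((k : Fin (3 + 3 * 2)), false).1 ∧ x.2 = true ∧ ((k : Fin (3 + 3 * 2)), false).2 = false then (-1 : ℤ) else 0)) * (M (v, !ct v) ((k : Fin (3 + 3 * 2)) + 1, true) * M (w, !ct w) ((k : Fin (3 + 3 * 2)), true)) + (∑ x : Fin (3 + 3 * 2) × Bool, M' x (j, ct j) * (if x.1 = ((k : Fin (3 + 3 * 2)) + 1, true).1 ∧ x.2 = false ∧ ((k : Fin (3 + 3 * 2)) + 1, true).2 = true then (1 : ℤ) else if x.1 = ((k : Fin (3 + 3 * 2)) + 1, true).1 ∧ x.2 = true ∧ ((k : Fin (3 + 3 * 2)) + 1, true).2 = false then (-1 : ℤ) else 0)) * (M (v, !ct v) ((k : Fin (3 + 3 * 2)), true) * M (w, !ct w) ((k :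 Fin (3 + 3 * 2)), false))) - ((∑ x : Fin (3 + 3 * 2) × Bool, M' x (j, ct j) * (if x.1 = ((k : Fin (3 + 3 * 2)), true).1 ∧ x.2 = false ∧ ((k : Fin (3 + 3 * 2)), true).2 = true then (1 : ℤ) else if x.1 = ((k : Fin (3 + 3 * 2)), true).1 ∧ x.2 = true ∧ ((k : Fin (3 + 3 * 2)), true).2 = false then (-1 : ℤ) else 0)) * (M (w, !ct w) ((k : Fin (3 + 3 * 2)), false) * M (v, !ct v) ((k : Fin (3 + 3 * 2)) + 1, true)) + (∑ x : Fin (3 + 3 * 2) × Bool, M' x (j, ct j) * (if x.1 = ((k : Fin (3 + 3 * 2)), false).1 ∧ x.2 = false ∧ ((k : Fin (3 + 3 * 2)), false).2 = true then (1 : ℤ) else if x.1 = ((k : Fin (3 + 3 * 2)), false).1 ∧ x.2 = true ∧ ((k : Fin (3 + 3 * 2)), false).2 = false then (-1 : ℤ) else 0)) * (M (w, !ct w) ((k : Fin (3 + 3 * 2)) + 1, true) * M (v, !ct v) ((k : Fin (3 + 3 * 2)), true)) + (∑ x : Fin (3 + 3 * 2) × Bool, M' x (j, ct j) * (if x.1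 = ((k : Fin (3 + 3 * 2)) + 1, true).1 ∧ x.2 = false ∧ ((k : Fin (3 + 3 * 2)) + 1, true).2 = true then (1 : ℤ) else if x.1 = ((k : Fin (3 + 3 * 2)) + 1, true).1 ∧ x.2 = true ∧ ((k : Fin (3 + 3 * 2)) + 1, true).2 = false then (-1 : ℤ) else 0)) * (M (w, !ct w) ((k : Fin (3 + 3 * 2)), true) * M (v, !ct v) ((k : Fin (3 + 3 * 2)), false))))) ) else (1 : FreeGroup (Fin (3 + 3 * 2))))).prod)).prod) = (((List.finRange (3 + 3 * 2)).map (fun v => ((List.finRange (3 + 3 * 2)).map (fun w => if v < w then ⁅(FreeGroup.of v : FreeGroup (Fin (3 + 3 * 2))), FreeGroup.of w⁆ ^ ( (((∑ x : Fin (3 + 3 * 2) × Bool, M' x (j, ct j) * (if x.1 = ((k : Fin (3 + 3 * 2)), true).1 ∧ x.2 = false ∧ ((k : Fin (3 + 3 * 2)), true).2 = true then (1 : ℤ) else if x.1 = ((k : Fin (3 + 3 * 2)), true).1 ∧ x.2 = true ∧ ((k : Fin (3 + 3 * 2)), true).2 = false then (-1 : ℤ) else 0)) * (M (v, !ct v)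 ((k : Fin (3 + 3 * 2)), false) * M (w, !ct w) ((k : Fin (3 + 3 * 2)) + 1, true)) + (∑ x : Fin (3 + 3 * 2) × Bool, M' x (j, ct j) * (if x.1 = ((k : Fin (3 + 3 * 2)), false).1 ∧ x.2 = false ∧ ((k : Fin (3 + 3 * 2)), false).2 = true then (1 : ℤ) else if x.1 = ((k : Fin (3 + 3 * 2)), false).1 ∧ x.2 = true ∧ ((k : Fin (3 + 3 * 2)), false).2 = false then (-1 : ℤ) else 0)) * (M (v, !ct v) ((k : Fin (3 + 3 * 2)) + 1, true) * M (w, !ct w) ((k : Fin (3 + 3 * 2)), true)) + (∑ x : Fin (3 + 3 * 2) × Bool, M' x (j, ct j) * (if x.1 = ((k : Fin (3 + 3 * 2)) + 1, true).1 ∧ x.2 = false ∧ ((k : Fin (3 + 3 * 2)) + 1, true).2 = true then (1 : ℤ) else if x.1 = ((k : Fin (3 + 3 * 2)) + 1, true).1 ∧ x.2 = true ∧ ((k : Fin (3 + 3 * 2)) + 1, true).2 = false then (-1 : ℤ) else 0)) * (M (v, !ct v) ((k : Fin (3 + 3 * 2)), true) * M (w, !ct w) ((k : Fin (3 + 3 *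 2)), false))) - ((∑ x : Fin (3 + 3 * 2) × Bool, M' x (j, ct j) * (if x.1 = ((k : Fin (3 + 3 * 2)), true).1 ∧ x.2 = false ∧ ((k : Fin (3 + 3 * 2)), true).2 = true then (1 : ℤ) else if x.1 = ((k : Fin (3 + 3 * 2)), true).1 ∧ x.2 = true ∧ ((k : Fin (3 + 3 * 2)), true).2 = false then (-1 : ℤ) else 0)) * (M (w, !ct w) ((k : Fin (3 + 3 * 2)), false) * M (v, !ct v) ((k : Fin (3 + 3 * 2)) + 1, true)) + (∑ x : Fin (3 + 3 * 2) × Bool, M' x (j, ct j) * (if x.1 = ((k : Fin (3 + 3 * 2)), false).1 ∧ x.2 = false ∧ ((k : Fin (3 + 3 * 2)), false).2 = true then (1 : ℤ) else if x.1 = ((k : Fin (3 + 3 * 2)), false).1 ∧ x.2 = true ∧ ((k : Fin (3 + 3 * 2)), false).2 = false then (-1 : ℤ) else 0)) * (M (w, !ct w) ((k : Fin (3 + 3 * 2)) + 1, true) * M (v, !ct v) ((k : Fin (3 + 3 * 2)), true)) + (∑ x : Fin (3 + 3 * 2) × Bool, M' x (j, ct j) * (if x.1 = ((k : Fin (3 +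 3 * 2)) + 1, true).1 ∧ x.2 = false ∧ ((k : Fin (3 + 3 * 2)) + 1, true).2 = true then (1 : ℤ) else if x.1 = ((k : Fin (3 + 3 * 2)) + 1, true).1 ∧ x.2 = true ∧ ((k : Fin (3 + 3 * 2)) + 1, true).2 = false then (-1 : ℤ) else 0)) * (M (w, !ct w) ((k : Fin (3 + 3 * 2)), true) * M (v, !ct v) ((k : Fin (3 + 3 * 2)), false)))) ) else (1 : FreeGroup (Fin (3 + 3 * 2))))).prod)).prod) :=
    pp_congr _ _ _ _ fun v w _ => by
      congr 1
      exact sign_mul_sign_mul (ct j) _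
  rw [key]
  exact hread


end ConjRealiser

/-! ## §2 Collapsing the pairing sums -/

section Collapse

variable {n : ℕ}

/-- `∑ₓ f x ⟨x, b_k⟩ = f a_k` (the pairing indicator against a `b`-letter picks the `a`-letter). [folklore] -/
theorem sum_mul_pairing_true (f : Fin n × Bool → ℤ) (k : Fin n) :
    (∑ x : Fin n × Bool, f x * (if x.1 = ((k : Fin n), true).1 ∧ x.2 = false ∧ ((k : Fin n), true).2 = true then (1 : ℤ) else if x.1 = ((k : Fin n), true).1 ∧ x.2 = true ∧ ((k : Fin n), true).2 = false then (-1 : ℤ) else 0)) = f (k, false) := by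
  rw [Finset.sum_eq_single (k, false)]
  · simp
  · rintro ⟨i, b⟩ - hne
    have : ¬ (i = k ∧ b = false) := fun h => hne (by rw [h.1, h.2])
    cases b <;> simp_all
  · exact fun h => (h (Finset.mem_univ _)).elim

/-- `∑ₓ f x ⟨x, a_k⟩ = -f b_k`. [folklore] -/
theorem sum_mul_pairing_false (f : Fin n × Bool → ℤ) (k : Fin n) :
    (∑ x : Fin n × Bool, f x * (if x.1 = ((k : Fin n), false).1 ∧ x.2 = false ∧ ((k : Fin n), false).2 = true then (1 : ℤ) else if x.1 = ((k : Fin n), false).1 ∧ x.2 = true ∧ ((k : Fin n), false).2 = false then (-1 : ℤ) else 0)) = -f (k, true) := by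
  rw [Finset.sum_eq_single (k, true)]
  · simp
  · rintro ⟨i, b⟩ - hne
    have : ¬ (i = k ∧ b = true) := fun h => hne (by rw [h.1, h.2])
    cases b <;> simp_all
  · exact fun h => (h (Finset.mem_univ _)).elim

end Collapse

/-! ## §3 Handle permutations -/

section Perm

variable {n : ℕ} (τ σ : Fin n → Fin n) (hστ : ∀ h, σ (τ h) = h) (hτσ : ∀ h, τ (σ h) = h)

include hστ hτσ

omit hτσ in
/-- `P_σ M · M' P_σ⁻¹ = 1` from `M M' = 1`. [folklore] -/
theorem perm_mul_eq_one (M M' : Matrix (Fin n × Bool) (Fin n × Bool) ℤ) (h1 : M * M' = 1) :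
    Matrix.of (fun p q : Fin n × Bool => M (τ p.1, p.2) q) *
      Matrix.of (fun p q : Fin n × Bool => M' p (τ q.1, q.2)) = 1 := by
  have hinj : ∀ a b : Fin n, τ a = τ b → a = b := fun a b h => by rw [← hστ a, h, hστ]
  ext p q
  have e : (M * M') (τ p.1, p.2) (τ q.1, q.2) = (1 : Matrix (Fin n × Bool) (Fin n × Bool) ℤ) (τ p.1, p.2) (τ q.1, q.2) := by
    rw [h1]
  simp only [Matrix.mul_apply, Matrix.one_apply, Matrix.of_apply] at e ⊢
  rw [e]
  obtain ⟨p1, p2⟩ := p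
  obtain ⟨q1, q2⟩ := q
  by_cases h : ((p1, p2) : Fin n × Bool) = (q1, q2)
  · rw [if_pos h, if_pos (by cases h; rfl)]
  · rw [if_neg h, if_neg]
    intro h'
    simp only [Prod.mk.injEq] at h'
    exact h (by rw [hinj _ _ h'.1, h'.2])

/-- `M' P_σ⁻¹ · P_σ M = 1` from `M' M = 1`. [folklore] -/
theorem perm_mul_eq_one' (M M' : Matrix (Fin n × Bool) (Fin n × Bool) ℤ) (h2 : M' * M = 1) :
    Matrix.of (fun p q : Fin n × Bool => M' p (τ q.1, q.2)) *
      Matrix.of (fun p q : Fin n × Bool => M (τ p.1, p.2) q) = 1 := by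
  ext p q
  have e : (M' * M) p q = (1 : Matrix (Fin n × Bool) (Fin n × Bool) ℤ) p q := by rw [h2]
  simp only [Matrix.mul_apply, Matrix.of_apply] at e ⊢
  rw [← e]
  exact Equiv.sum_comp (Equiv.prodCongr (Equiv.mk τ σ hστ hτσ) (Equiv.refl Bool)) (fun r => M' p r * M r q)

/-- The intersection form is invariant under handle permutations. [folklore] -/
theorem symplForm_perm (u v : Fin n × Bool → ℤ) :
    symplForm (fun q : Fin n × Bool => u (τ q.1, q.2)) (fun q : Fin n × Bool => v (τ q.1, q.2)) = symplForm u v := by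
  rw [symplForm_apply, symplForm_apply]
  exact Equiv.sum_comp (Equiv.mk τ σ hστ hτσ) (fun i => u (i, false) * v (i, true) - u (i, true) * v (i, false))

/-- `Sp`-columns of `P_σ M` from those of `M`. [folklore] -/
theorem perm_symplForm_col (M : Matrix (Fin n × Bool) (Fin n × Bool) ℤ) (ε : ℤ)
    (hS : ∀ x y : Fin n × Bool, symplForm (fun q => M q x) (fun q => M q y) =
      ε * symplForm (Pi.single x (1 : ℤ) : Fin n × Bool → ℤ) (Pi.single y (1 : ℤ))) :
    ∀ x y : Fin n × Bool, symplForm (fun q => Matrix.of (fun p q : Fin n × Bool => M (τ p.1, p.2) q) q x)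
      (fun q => Matrix.of (fun p q : Fin n × Bool => M (τ p.1, p.2) q) q y) =
      ε * symplForm (Pi.single x (1 : ℤ) : Fin n × Bool → ℤ) (Pi.single y (1 : ℤ)) := by
  intro x y
  rw [← hS x y]
  simp only [Matrix.of_apply]
  exact symplForm_perm τ σ hστ hτσ (fun q => M q x) (fun q => M q y)

omit hστ hτσ in
/-- Vanishing blocks of `P_σ M` from those of `M`, for a residue-preserving `τ`. [folklore] -/
theorem perm_block (M : Matrix (Fin n × Bool) (Fin n × Bool) ℤ) (r : ℕ)
    (hτ : ∀ h : Fin n, ((τ h : Fin n) : ℕ) % 3 = ((h : Fin n) : ℕ) % 3)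
    (h0 : ∀ i j : Fin n, M (i, !decide ((i : ℕ) % 3 = r)) (j, decide ((j : ℕ) % 3 = r)) = 0) :
    ∀ i j : Fin n, Matrix.of (fun p q : Fin n × Bool => M (τ p.1, p.2) q)
      (i, !decide ((i : ℕ) % 3 = r)) (j, decide ((j : ℕ) % 3 = r)) = 0 := by
  intro i j
  rw [Matrix.of_apply, ← hτ i]
  exact h0 (τ i) j

end Perm

/-! ## §4 Permuted conjugated seed realisers at genus `9` with collapsed readings -/

section PermRealiser

/-- **A permuted conjugated seed realiser and its collapsed reading** (genus `9`).  For a base matrix `M` (inverse `M'`,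
sign `ε`) passing the Goeritz checks, a residue-preserving handle permutation `τ` (inverse `σ`) and a handle `k`, the
conjugate `y = x bp_{k,k+1} x⁻¹` of the bounding-pair map by a Goeritz element `x` realising `P_σ M` lies in
`Stab N₀ ∩ Stab N₁`, is IA, and reads through `π` as the collapsed closed form `RD'` of the module docstring. [folklore] -/
theorem exists_perm_conj_realiser₉ (k : Fin (3 + 3 * 2)) (M M' : Matrix (Fin (3 + 3 * 2) × Bool) (Fin (3 + 3 * 2) × Bool) ℤ) (ε : ℤ) (hε : ε = 1 ∨ ε = -1)
    (h1 : M * M' = 1) (h2 : M' * M = 1)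
    (hS : ∀ x y : Fin (3 + 3 * 2) × Bool, symplForm (fun q => M q x) (fun q => M q y) =
      ε * symplForm (Pi.single x (1 : ℤ) : Fin (3 + 3 * 2) × Bool → ℤ) (Pi.single y (1 : ℤ)))
    (h0 : ∀ i j : Fin (3 + 3 * 2), M (i, !decide ((i : ℕ) % 3 = 2)) (j, decide ((j : ℕ) % 3 = 2)) = 0)
    (h1' : ∀ i j : Fin (3 + 3 * 2), M (i, !decide ((i : ℕ) % 3 = 1)) (j, decide ((j : ℕ) % 3 = 1)) = 0)
    (τ σ : Fin (3 + 3 * 2) → Fin (3 + 3 * 2)) (hστ : ∀ h, σ (τ h) = h) (hτσ : ∀ h, τ (σ h) = h)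
    (hτ : ∀ h : Fin (3 + 3 * 2), ((τ h : Fin (3 + 3 * 2)) : ℕ) % 3 = ((h : Fin (3 + 3 * 2)) : ℕ) % 3)
    {ct : Fin (3 + 3 * 2) → Bool} {π : (SurfaceGroup (3 + 3 * 2)) →* (FreeGroup (Fin (3 + 3 * 2)))} (hπs : Function.Surjective π)
    (hπof : ∀ (h : Fin (3 + 3 * 2)) (b : Bool), π (PresentedGroup.of (h, b)) = if b = ct h then 1 else FreeGroup.of h) :
    ∃ y : (SurfaceGroup (3 + 3 * 2)) ≃* (SurfaceGroup (3 + 3 * 2)),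
      (s4Kernels.stabilizeIter 2 0).map y.toMonoidHom = s4Kernels.stabilizeIter 2 0 ∧
      (s4Kernels.stabilizeIter 2 1).map y.toMonoidHom = s4Kernels.stabilizeIter 2 1 ∧
      (∀ s : (SurfaceGroup (3 + 3 * 2)), y s * s⁻¹ ∈ ((⊤ : Subgroup (SurfaceGroup (3 + 3 * 2))).lowerCentralSeries 1)) ∧
      ∀ j : Fin (3 + 3 * 2), π (y (PresentedGroup.of (j, ct j)) * (PresentedGroup.of (j, ct j))⁻¹) *
        (((List.finRange (3 + 3 * 2)).map (fun v => ((List.finRange (3 + 3 * 2)).map (fun w => if v < w then ⁅(FreeGroup.of v : FreeGroup (Fin (3 + 3 * 2))), FreeGroup.of w⁆ ^ ((if ct j then (-1 : ℤ) else 1) * ((if ct j then (-1 : ℤ) else 1) * ((M' ((k : Fin (3 + 3 * 2)), false) (τ j, ct j) * (M (τ v, !ct v) ((k : Fin (3 + 3 * 2)), false) * M (τ w, !ct w) ((k : Fin (3 + 3 * 2)) + 1, true)) + -M' ((k : Fin (3 + 3 * 2)), true) (τ j, ct j) * (M (τ v, !ct v) ((k : Fin (3 + 3 * 2)) + 1,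 true) * M (τ w, !ct w) ((k : Fin (3 + 3 * 2)), true)) + M' ((k : Fin (3 + 3 * 2)) + 1, false) (τ j, ct j) * (M (τ v, !ct v) ((k : Fin (3 + 3 * 2)), true) * M (τ w, !ct w) ((k : Fin (3 + 3 * 2)), false))) - (M' ((k : Fin (3 + 3 * 2)), false) (τ j, ct j) * (M (τ w, !ct w) ((k : Fin (3 + 3 * 2)), false) * M (τ v, !ct v) ((k : Fin (3 + 3 * 2)) + 1, true)) + -M' ((k : Fin (3 + 3 * 2)), true) (τ j, ct j) * (M (τ w, !ct w) ((k : Fin (3 + 3 * 2)) + 1, true) * M (τ v, !ct v) ((k : Fin (3 + 3 * 2)), true)) + M' ((k : Fin (3 + 3 * 2)) + 1, false) (τ j, ct j) * (M (τ w, !ct w) ((k : Fin (3 + 3 * 2)), true) * M (τ v, !ct v) ((k : Fin (3 + 3 * 2)), false)))))) else (1 : FreeGroup (Fin (3 + 3 * 2))))).prod)).prod)⁻¹ ∈ ((⊤ : Subgroup (FreeGroup (Fin (3 + 3 * 2)))).lowerCentralSeries 2) := by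
  obtain ⟨y, hy0, hy1, hyIA, hyD⟩ := exists_conj_realiser₉ k
    (Matrix.of (fun p q : Fin (3 + 3 * 2) × Bool => M (τ p.1, p.2) q)) (Matrix.of (fun p q : Fin (3 + 3 * 2) × Bool => M' p (τ q.1, q.2))) ε hε
    (perm_mul_eq_one τ σ hστ M M' h1) (perm_mul_eq_one' τ σ hστ hτσ M M' h2) (perm_symplForm_col τ σ hστ hτσ M ε hS)
    (perm_block τ M 2 hτ h0) (perm_block τ M 1 hτ h1') hπs hπof
  refine ⟨y, hy0, hy1, hyIA, fun j => ?_⟩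
  have key : (((List.finRange (3 + 3 * 2)).map (fun v => ((List.finRange (3 + 3 * 2)).map (fun w => if v < w then ⁅(FreeGroup.of v : FreeGroup (Fin (3 + 3 * 2))), FreeGroup.of w⁆ ^ ((if ct j then (-1 : ℤ) else 1) * ((if ct j then (-1 : ℤ) else 1) * (((∑ x : Fin (3 + 3 * 2) × Bool, (Matrix.of (fun p q : Fin (3 + 3 * 2) × Bool => M' p (τ q.1, q.2))) x (j, ct j) * (if x.1 = ((k : Fin (3 + 3 * 2)), true).1 ∧ x.2 = false ∧ ((k : Fin (3 + 3 * 2)), true).2 = true then (1 : ℤ) else if x.1 = ((k : Fin (3 + 3 * 2)), true).1 ∧ x.2 = true ∧ ((k : Fin (3 + 3 * 2)), true).2 = false then (-1 : ℤ) else 0)) * ((Matrix.of (fun p q : Fin (3 + 3 * 2) × Bool => M (τ p.1, p.2) q)) (v, !ct v) ((k : Fin (3 + 3 * 2)), false) * (Matrix.of (fun p q : Fin (3 + 3 * 2) × Bool => M (τ p.1, p.2) q)) (w, !ct w) ((k : Fin (3 + 3 * 2)) + 1, true)) + (∑ x : Fin (3 + 3 * 2) × Bool, (Matrix.of (fun p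 q : Fin (3 + 3 * 2) × Bool => M' p (τ q.1, q.2))) x (j, ct j) * (if x.1 = ((k : Fin (3 + 3 * 2)), false).1 ∧ x.2 = false ∧ ((k : Fin (3 + 3 * 2)), false).2 = true then (1 : ℤ) else if x.1 = ((k : Fin (3 + 3 * 2)), false).1 ∧ x.2 = true ∧ ((k : Fin (3 + 3 * 2)), false).2 = false then (-1 : ℤ) else 0)) * ((Matrix.of (fun p q : Fin (3 + 3 * 2) × Bool => M (τ p.1, p.2) q)) (v, !ct v) ((k : Fin (3 + 3 * 2)) + 1, true) * (Matrix.of (fun p q : Fin (3 + 3 * 2) × Bool => M (τ p.1, p.2) q)) (w, !ct w) ((k : Fin (3 + 3 * 2)), true)) + (∑ x : Fin (3 + 3 * 2) × Bool, (Matrix.of (fun p q : Fin (3 + 3 * 2) × Bool => M' p (τ q.1, q.2))) x (j, ct j) * (if x.1 = ((k : Fin (3 + 3 * 2)) + 1, true).1 ∧ x.2 = false ∧ ((k : Fin (3 + 3 * 2)) + 1, true).2 = true then (1 : ℤ) else if x.1 = ((k : Fin (3 + 3 * 2)) + 1, true).1 ∧ x.2 = true ∧ ((k : Fin (3 + 3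 * 2)) + 1, true).2 = false then (-1 : ℤ) else 0)) * ((Matrix.of (fun p q : Fin (3 + 3 * 2) × Bool => M (τ p.1, p.2) q)) (v, !ct v) ((k : Fin (3 + 3 * 2)), true) * (Matrix.of (fun p q : Fin (3 + 3 * 2) × Bool => M (τ p.1, p.2) q)) (w, !ct w) ((k : Fin (3 + 3 * 2)), false))) - ((∑ x : Fin (3 + 3 * 2) × Bool, (Matrix.of (fun p q : Fin (3 + 3 * 2) × Bool => M' p (τ q.1, q.2))) x (j, ct j) * (if x.1 = ((k : Fin (3 + 3 * 2)), true).1 ∧ x.2 = false ∧ ((k : Fin (3 + 3 * 2)), true).2 = true then (1 : ℤ) else if x.1 = ((k : Fin (3 + 3 * 2)), true).1 ∧ x.2 = true ∧ ((k : Fin (3 + 3 * 2)), true).2 = false then (-1 : ℤ) else 0)) * ((Matrix.of (fun p q : Fin (3 + 3 * 2) × Bool => M (τ p.1, p.2) q)) (w, !ct w) ((k : Fin (3 + 3 * 2)), false) * (Matrix.of (fun p q : Fin (3 + 3 * 2) × Bool => M (τ p.1, p.2) q)) (v, !ct v) ((k : Fin (3 + 3 * 2)) + 1, true)) + (∑ x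 : Fin (3 + 3 * 2) × Bool, (Matrix.of (fun p q : Fin (3 + 3 * 2) × Bool => M' p (τ q.1, q.2))) x (j, ct j) * (if x.1 = ((k : Fin (3 + 3 * 2)), false).1 ∧ x.2 = false ∧ ((k : Fin (3 + 3 * 2)), false).2 = true then (1 : ℤ) else if x.1 = ((k : Fin (3 + 3 * 2)), false).1 ∧ x.2 = true ∧ ((k : Fin (3 + 3 * 2)), false).2 = false then (-1 : ℤ) else 0)) * ((Matrix.of (fun p q : Fin (3 + 3 * 2) × Bool => M (τ p.1, p.2) q)) (w, !ct w) ((k : Fin (3 + 3 * 2)) + 1, true) * (Matrix.of (fun p q : Fin (3 + 3 * 2) × Bool => M (τ p.1, p.2) q)) (v, !ct v) ((k : Fin (3 + 3 * 2)), true)) + (∑ x : Fin (3 + 3 * 2) × Bool, (Matrix.of (fun p q : Fin (3 + 3 * 2) × Bool => M' p (τ q.1, q.2))) x (j, ct j) * (if x.1 = ((k : Fin (3 + 3 * 2)) + 1, true).1 ∧ x.2 = false ∧ ((k : Fin (3 + 3 * 2)) + 1, true).2 = true then (1 : ℤ) else if x.1 = ((k : Fin (3 + 3 * 2)) + 1,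 true).1 ∧ x.2 = true ∧ ((k : Fin (3 + 3 * 2)) + 1, true).2 = false then (-1 : ℤ) else 0)) * ((Matrix.of (fun p q : Fin (3 + 3 * 2) × Bool => M (τ p.1, p.2) q)) (w, !ct w) ((k : Fin (3 + 3 * 2)), true) * (Matrix.of (fun p q : Fin (3 + 3 * 2) × Bool => M (τ p.1, p.2) q)) (v, !ct v) ((k : Fin (3 + 3 * 2)), false)))))) else (1 : FreeGroup (Fin (3 + 3 * 2))))).prod)).prod) =
      (((List.finRange (3 + 3 * 2)).map (fun v => ((List.finRange (3 + 3 * 2)).map (fun w => if v < w then ⁅(FreeGroup.of v : FreeGroup (Fin (3 + 3 * 2))), FreeGroup.of w⁆ ^ ((if ct j then (-1 : ℤ) else 1) * ((if ct j then (-1 : ℤ) else 1) * ((M' ((k : Fin (3 + 3 * 2)), false) (τ j, ct j) * (M (τ v, !ct v) ((k : Fin (3 + 3 * 2)), false) * M (τ w, !ct w) ((k : Fin (3 + 3 * 2)) + 1, true)) + -M' ((k : Fin (3 + 3 * 2)), true) (τ j, ct j) * (M (τ v, !ct v) ((k : Fin (3 + 3 * 2)) + 1, true) * M (τ w, !ct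 w) ((k : Fin (3 + 3 * 2)), true)) + M' ((k : Fin (3 + 3 * 2)) + 1, false) (τ j, ct j) * (M (τ v, !ct v) ((k : Fin (3 + 3 * 2)), true) * M (τ w, !ct w) ((k : Fin (3 + 3 * 2)), false))) - (M' ((k : Fin (3 + 3 * 2)), false) (τ j, ct j) * (M (τ w, !ct w) ((k : Fin (3 + 3 * 2)), false) * M (τ v, !ct v) ((k : Fin (3 + 3 * 2)) + 1, true)) + -M' ((k : Fin (3 + 3 * 2)), true) (τ j, ct j) * (M (τ w, !ct w) ((k : Fin (3 + 3 * 2)) + 1, true) * M (τ v, !ct v) ((k : Fin (3 + 3 * 2)), true)) + M' ((k : Fin (3 + 3 * 2)) + 1, false) (τ j, ct j) * (M (τ w, !ct w) ((k : Fin (3 + 3 * 2)), true) * M (τ v, !ct v) ((k : Fin (3 + 3 * 2)), false)))))) else (1 : FreeGroup (Fin (3 + 3 * 2))))).prod)).prod) :=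
    pp_congr _ _ _ _ fun v w _ => by
      congr 1
      rw [sum_mul_pairing_true, sum_mul_pairing_true, sum_mul_pairing_false]
      simp only [Matrix.of_apply]
  rw [← key]
  exact hyD j

end PermRealiser

/-! ## Registered helper -/

/-- **Registered helper `helper_symplFormPerm`** (sub-goal of stub `stub_layerStepTwoZero`, crux stmt-SmoothPoincare4-14595):
the intersection form of `H₁(Σ_n) = ℤ^{Fin n × Bool}` is invariant under permutations of the handles. [folklore] -/
theorem helper_symplFormPerm : ∀ (n : ℕ) (τ σ : Fin n → Fin n), (∀ h, σ (τ h) = h) → (∀ h, τ (σ h) = h) → ∀ u v : Fin n × Bool → ℤ, symplForm (fun q : Fin n × Bool => u (τ q.1, q.2)) (fun q : Fin n × Bool => v (τ q.1, q.2)) = symplForm u v :=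
  fun _ τ σ hστ hτσ u v => symplForm_perm τ σ hστ hτσ u v

end Summit.SmoothPoincare4.SmoothPoincare4.Theorems.ShadowApproximation.NilpotentGenusClass

end
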